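import Summits.AtomisticToContinuum.HydrodynamicLimit.Theorems.JParityClosureOddContactSymmetryL2ToProbability
import HarnessLib

/-!
# `L² →` probability for a time-integrated one-time functional (`stub_l2ToProbability`, S5 of the
# crux line `even-rung-mean-variance`, `JParityClosure.EvenStressEnskog`,
# stmt-AtomisticToContinuum-13079)

A finite-`N` inequality of pure probability (Cauchy–Schwarz in time plus Chebyshev–Markov on the
square; no dynamics beyond joint measurability of the flow, no stationarity, no limit).  For the
probability measure `P = localGibbsLaw σ a₀ u₀ θ₀ N Φ`, a jointly measurable family
`X : ℝ → Config (N+1) (Fin 3) 𝕋³ → ℝ` with `|X t z| ≤ B` on `[0, τ] × Config`, time-integrated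
mean `|∫₀^τ E_P[X_t ∘ Φ_t] dt| ≤ m < η` and fixed-time variances `Var_P(X_t ∘ Φ_t) ≤ ς` on `[0, τ]`:
`P {η < |∫₀^τ X_t(Φ_t z) dt|} ≤ τ² ς / (η − m)²`.

This is verbatim the tree theorem
`Summit.AtomisticToContinuum.HydrodynamicLimit.Theorems.measure_lt_abs_setIntegral_flow_le`
(file `Theorems/JParityClosureOddContactSymmetryL2ToProbability.lean`, proved for the sibling crux
stmt-AtomisticToContinuum-13078, whose S5 is the instance `X := tubeStat …`), applied with `A := X`;
the composition `EvenStressEnskog_of` of the present line feeds it `X t z := evenTubeStat … t z`.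

References: standard (Chebyshev–Markov and Cauchy–Schwarz); H. Spohn, *Large Scale Dynamics of
Interacting Particles* (1991), Part I §2 for the setting.
-/

noncomputable section

open MeasureTheory ProbabilityTheory Set
open scoped ENNReal

namespace Summit.AtomisticToContinuum.HydrodynamicLimit.Theorems.EvenStressEnskog

open Literature.Analysis.FluidPDE Literature.MathematicalPhysics.KineticTheory

/-- **S5 · Cauchy–Schwarz–Chebyshev, `L² →` probability** (registered stub `stub_l2ToProbability`
of the line `even-rung-mean-variance`).  For every `σ`, profiles `a₀, θ₀, u₀`, `N`, hard-sphere
flow `Φ`, `τ > 0`, jointly measurable family `X` with `|X t z| ≤ B` on `[0, τ] × Config`, `ς ≥ 0`,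
`m < η`: if `P = localGibbsLaw …` is a probability measure, the time-integrated mean of `X_t ∘ Φ_t`
under `P` has modulus `≤ m` and `Var_P(X_t ∘ Φ_t) ≤ ς` for every `t ∈ [0, τ]`, then
`P {η < |∫₀^τ X_t(Φ_t z) dt|} ≤ τ²ς/(η − m)²`: the instance `A := X` of
`measure_lt_abs_setIntegral_flow_le`. [folklore] -/
theorem stub_l2ToProbability :
    ∀ (σ : ℝ) (a₀ θ₀ : T3 → ℝ) (u₀ : T3 → V3) (N : ℕ)
      (Φ : HardSphereFlow (Torus.geometry (Fin 3)) (hsDiameter σ N) (N + 1))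
      (τ : ℝ) (X : ℝ → Config (N + 1) (Fin 3) T3 → ℝ) (m ς η B : ℝ),
      IsProbabilityMeasure (localGibbsLaw σ a₀ u₀ θ₀ N Φ) →
      Measurable (fun p : ℝ × Config (N + 1) (Fin 3) T3 => X p.1 p.2) →
      (∀ t ∈ Set.Icc (0 : ℝ) τ, ∀ z : Config (N + 1) (Fin 3) T3, |X t z| ≤ B) →
      0 < τ → 0 ≤ ς → m < η →
      |∫ t in Set.Icc (0 : ℝ) τ, ∫ z, X t (Φ.flow t z) ∂(localGibbsLaw σ a₀ u₀ θ₀ N Φ)| ≤ m →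
      (∀ t ∈ Set.Icc (0 : ℝ) τ,
        ProbabilityTheory.variance (fun z => X t (Φ.flow t z)) (localGibbsLaw σ a₀ u₀ θ₀ N Φ) ≤ ς) →
      localGibbsLaw σ a₀ u₀ θ₀ N Φ {z | η < |∫ t in Set.Icc (0 : ℝ) τ, X t (Φ.flow t z)|}
        ≤ ENNReal.ofReal (τ ^ 2 * ς / (η - m) ^ 2) := by
  intro σ a₀ θ₀ u₀ N Φ τ X m ς η B hP hmeas hB hτ _hς hmη hmean hvar
  exact measure_lt_abs_setIntegral_flow_le σ a₀ θ₀ u₀ N Φ hmeas hB hτ hmη hmean hvar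

end Summit.AtomisticToContinuum.HydrodynamicLimit.Theorems.EvenStressEnskog
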